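import Literature.MathematicalPhysics.QuantumFieldTheory.Balaban1983to89.B9Thm33G0DivRAtPins
import Literature.MathematicalPhysics.QuantumFieldTheory.Balaban1983to89.B9LettersHHZWholeAtPins
import Literature.MathematicalPhysics.QuantumFieldTheory.Balaban1983to89.B9BackgroundsKLevelV1R

/-!
# `Balaban1983to89.B9Thm33G0DivRLettersHHZAtPinsR` — [B9] Theorem 3.12 ∕ 3.13 (pp. 421–426): the W-c faces `hdiv.h44Ds` (`D*_U G₀ ∇*_{U,μ}`, (3.44)) and `hLHH`
# (`Φ^Y_β ∇_U G₀ Q*`, the `LettersHHZ` schema) and their two kinematic letters `Q*(U)`, `J†_ν(U)` AT THE PINS, RE-TYPED ONCE OVER A GENERIC BACKGROUND CARRIER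
# `(B, rd)` AND AT node00-def-Y's CLASS-PARAMETRIC MEMBER CARRIER `bg9YR (M_N ℂ) SU(N) R₁ R₂ x` (dag-lead CASCADE-R, STEP 2 for rows 19–21)

T. Bałaban, *Propagators for lattice gauge theories in a background field*, Commun. Math. Phys. **99** (1985) 389–434
[`Balaban1985BackgroundPropagators`, "B9"]; [4] = T. Bałaban, *Propagators and renormalization transformations for lattice gauge
theories. II*, Commun. Math. Phys. **96** (1984) 223–250 [`Balaban1984PropagatorsII`].

statement-level skeleton of published theorems with citation tags; proofs where landed; nothing here is a claim about the Yang–Mills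
mass gap

THE POINT (cell `pub-ymgap`, node N06 [B9]; width seat w5; dag-n06-d g12's STEP-3 FACE CENSUS, pub-ymgap INBOX 2026-08-28 14:20Z).  The member-level faces
`B9Thm33G0DivRAtPins.h44Ds_pins` (p621802) and `B9LettersHHZWholeAtPins.lettersHHZ_pins` (p628142), and the letters `B9QstarLettersAtPins.hasMaj_Qstar_pins` ∕
`B9DivViaGradLettersAtPins.hasMaj_JTcoKH_pins` under them, type their objects and their regularity premise at MODULE 3's member carrier
`bg9Y (M_N ℂ) SU(N) x` LITERALLY (`(bg9Y …).Reg335 c α₀ U`).  Their proofs read that premise ONLY through «`U` is `SU(N)`-valued» (contracting link variables and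
taxi transporters, `‖u‖, ‖u⁻¹‖ ≤ 1`), and every engine below them (`hasMaj_QscoKH`, `hasMaj_JTcoKH`, `DvscoKH_eq_sum`, `h44Ds_of_h44m`, `pQ_of_h43`) is already typed
over an ARBITRARY background carrier `B : B9.Backgrounds` read into the member's configurations by `rd : B.Cfg → CfgY (M_N ℂ) x.toKIdx`.  This file re-presses the four
statements ONCE:
* §1 (ANY carrier `(B, rd)`, hypothesis `hUG : ∀ μ z, rd U μ z ∈ SU(N)`): ★★ `hasMaj_Qstar_of_mem` (the sup letter of `Q*(U)` at `QscoKH x.toKIdx (trBasis N) B rd (parBY …) U`),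
  ★★ `hasMaj_JTcoKH_of_mem` (the sup letter of `J†_ν(U)` at `JTcoKH x.toKIdx (trBasis N) B rd ν U`);
* §2 (ANY carrier): ★★★ `h44Ds_of_mem` — `hdiv.h44Ds` for `{𝔬 : Ops (geo9Y x) B …}` under the pins `hDvs : 𝔬.Dvstar U = DvscoKH … B rd U`,
  `hDd : Dd U = fun ν => coordOpK (trBasis N) (fun _ => cdBₗ x.toKIdx (rd U) ν)`, `hblk ∕ hblkW ∕ hbHX` (statement otherwise VERBATIM `h44Ds_pins`);
  ★★★ `lettersHHZ_of_mem` — the WHOLE `LettersHHZ` face under the pin `hQs : 𝔬.Qstar U = QscoKH … B rd (parBY …) U` (otherwise VERBATIM `lettersHHZ_pins`);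
* §3 (node00-def-Y's CLASS-PARAMETRIC CARRIER `B9BackgroundsKLevelV1R.bg9YR (M_N ℂ) SU(N) R₁ R₂ x`, `rd := fun U => U`, premise `(bg9YR …).Reg335 c α₀ U` with the
  class constant `c` FREE and the class axiom `hG : MemOfFam SU(N) R₁`; convention of dag-n06-w8's `…N06HTransposeAtPinsPhysR`): ★★ `hasMaj_Qstar_pinsR`,
  ★★ `hasMaj_JTcoKH_pinsR`, ★★★ `h44Ds_pinsR`, ★★★ `lettersHHZ_pinsR`, ★★ `lettersHHZ_pinsR_closed`.
The MODULE 3 editions (`bg9Y` = `bg9YR … (regY335) (regY336)` by `B9BackgroundsKLevelV1R.bg9Y_eq_bg9YR`, `rfl`; `hG := memOfFam_regY335`) are the landed originals and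
are NOT re-derived here; the MODULE 3-P editions (print's class, `bg9YP`) are the `regYP335 ∕ regYP336 ∕ memOfFam_regYP335` instances of §3.
KNIT (dag-n06-d, an R-generic edition): `hdivDs`'s first field := `h44Ds_pinsR x (hβ1 x) hG hU (hbHXA x) hrow … (hblk12 x) (hblkW12 x) (hDvsco12 x U) (h𝔡Ad x U) (… Thm33G0Dir) μ ε hε`;
`hLHH := lettersHHZ_pinsR x (hβ1 x) hG hU hrow hc hBh hδQ hδ₃ hδ₃0 hδ₃Q hBq (hblk12 x) (hblkZ12 x) (hQsco12 x U) (… Thm33G0Dir) hpl` — argument order = the originals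
with `hG` inserted before `hU`.

HONEST SCOPE.  Mechanical re-typing (generalisation of the background carrier) of landed by-name compositions; nothing of [B9]'s propagator estimates asserted
(`Thm33G0Dir`, rows 19's content, is a HYPOTHESIS of every face); COUNT-NEUTRAL; N06 is NOT discharged; one finite lattice at a time; nothing continuum, nothing
about the mass gap ∕ Clay.  Cell `pub-ymgap` (HUMAN RULING D-0062 ∕ D-0154), Track A node N06 [B9], width seat `pub-ymgap-dag-n06-w5` (g6), 2026-08-28.
No `sorry`, no `axiom`, no `def`, no `instance`, no `notation`.
-/

noncomputable section

namespace Literature.MathematicalPhysics.QuantumFieldTheory.Balaban1983to89.B9Thm33G0DivRLettersHHZAtPinsR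

open scoped Matrix.Norms.L2Operator
open Node00 B6GlobalChartV1 B6KLevelCensusIndexV1
open B6Geom246MultiLevelTorus (geomT)
open B6Ineq2142KLevelV1 (β lvl)
open B7Prop2SpecialUnitary (specialUnitaryUnits specialUnitaryUnits_le_U1)
open B9PinMembersKLevelV1 (MemberY geo9Y bg9Y)
open B9BackgroundsKLevelV1R (RegFamY bg9YR MemOfFam mem_of_reg335R)
open B9CoReadingCoordsTranspose (TrIdx trBasis)
open B9CoReadingCoords (XBK coordOpK cdBₗ blkBK)
open B9CoReadingCoordsS (XSK blkSK sIK)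
open B9CoReadingCoordsH (XHK blkHK)
open B9CoReadingCoordsInput (bHK)
open B9CoRealizesRelAtLetters (RelB)
open B9GeoNormsKLevelV1 (geo9K geo9K_dist_nonneg)
open B9GeoLemma21KLevelV1 (geo9Y_dist_triangle geo9Y_dist_comm geo9Y_len_pos)
open B9Thm39ReadingCoords (cR39 cR39_nonneg)
open B9Thm34Ext (toB6)
open B9SectDSup (weightNorm)
open B11SectG (HasMaj BlockNorm RowSum)
open B9Thm312Whole (Ops GeoOK cNorm)
open B9Thm312WholeClasses (cNormR)
open B9RWSums343Holder (HolderProbes)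
open B9Thm312WholeDir (Thm33G0Dir)
open B9Thm312WholeHZ (LettersHHZ)
open Node00.OpsYSectDCoords (QscoKH DvscoKH)
open B9GradViaDivLettersAtPins (rJ)
open B9DivViaGradLettersAtPins (JTcoKH DvscoKH_eq_sum hasMaj_JTcoKH bHK_dom)
open B9QstarLettersAtPins (hasMaj_QscoKH)
open B9Thm33G0DivRFromDir (h44Ds_of_h44m)
open B9Thm313WholeQstarFromG0 (pQ_of_h43)

variable {d ℓ : ℕ} {hd : 1 ≤ d + 1} {hL : Odd (ℓ + 1) ∧ 1 < ℓ + 1} {b₀ b₁ : ℝ} {Mstar : ℕ} {N : ℕ} [NeZero N]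
variable [∀ x : MemberY d ℓ hd hL b₀ b₁ Mstar, Fintype (geo9Y x).Site]

/-! ## §1 The two kinematic letters over ANY background carrier `(B, rd)` read into the member's configurations, at an `SU(N)`-valued `rd U` -/

section Letters

/-- ★★ **THE SUP LETTER `Q*(U)` AT THE PINS OVER ANY BACKGROUND CARRIER**: for `B : B9.Backgrounds` read into the member's configurations by `rd` and an
`SU(N)`-valued `rd U` (so the taxi transporters `parBY (rd U)` are `SU(N)`-valued, `Node00.parBY_mem`, hence contractions with contracting inverses,
`specialUnitaryUnits_le_U1`), at `QscoKH x.toKIdx (trBasis N) B rd (parBY x.toKIdx) U`, block maps `blkHK` ∕ `blkBK bI` (`bI` 1-faithful):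
`HasMaj (weightNorm (ofBlocks blkHK) n⁻¹ _) (cNorm R₀ H₀ (blkBK bI) _ 0) (Q*(U)) (e^{δ(ℓ+4)}·e^{−δd})`, every `δ ≥ 0` — `B9QstarLettersAtPins.hasMaj_QscoKH` by name.
[cite: Balaban1985BackgroundPropagators, (3.12)–(3.14) p.393, (3.110) p.417, (3.35) p.396 («U has values in G»), (3.40) p.397, Thm 3.13 p.426; Balaban1984PropagatorsI, (1.18) p.20; Balaban1984PropagatorsII, (2.51) p.232] -/
theorem hasMaj_Qstar_of_mem (x : MemberY d ℓ hd hL b₀ b₁ Mstar) {bI : FBondY x.toKIdx → IBondY x.toKIdx}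
    (hβ1 : ∀ f : FBondY x.toKIdx, (geomT x.D).dist (β x.hN x.D x.hk (bI f)) (blkV1 x.hN x.D f) ≤ 1)
    (B : B9.Backgrounds) (rd : B.Cfg → CfgY (Matrix (Fin N) (Fin N) ℂ) x.toKIdx) {U : B.Cfg}
    (hUG : ∀ μ z, rd U μ z ∈ specialUnitaryUnits (Fin N))
    {δ : ℝ} (hδ : 0 ≤ δ) {R₀ : ℝ} {H₀ : Prop} (hlen : ∀ y : (geo9Y x).Site, 0 ≤ (geo9Y x).len y)
    (hpl : ∀ y : (geo9Y x).Site, 0 ≤ ((((ℓ + 1 : ℕ) : ℝ) ^ (d + 1)) ^ lvl x.hN x.D x.hk y)⁻¹) :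
    HasMaj (weightNorm (BlockNorm.ofBlocks (toB6 (geo9Y x) R₀ H₀) (blkHK x.toKIdx))
        (fun y => ((((ℓ + 1 : ℕ) : ℝ) ^ (d + 1)) ^ lvl x.hN x.D x.hk y)⁻¹) hpl)
      (cNorm R₀ H₀ (blkBK x.toKIdx bI) hlen 0)
      (QscoKH x.toKIdx (trBasis N) B rd (parBY x.toKIdx) U)
      (fun a a' => Real.exp (δ * ((ℓ : ℝ) + 4)) * Real.exp (-(δ * (geo9Y x).dist a a'))) := by
  letI : Fintype (geo9K x.toKIdx).Site := (inferInstance : Fintype (geo9Y x).Site)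
  exact hasMaj_QscoKH x.toKIdx (trBasis N) B rd (parBY x.toKIdx) hβ1
    (fun s s' => specialUnitaryUnits_le_U1 (parBY_mem x.toKIdx (G := specialUnitaryUnits (Fin N)) hUG s s')) hδ hlen hpl

/-- ★★ **THE SUP LETTER `J†_ν(U)` AT THE PINS OVER ANY BACKGROUND CARRIER**: for `B` read by `rd` and an `SU(N)`-valued `rd U` (contracting link variables,
`specialUnitaryUnits_le_U1`), at `JTcoKH x.toKIdx (trBasis N) B rd ν U`, block maps `blkBK bI` ∕ `blkSK (sIK bI)` (`bI` 1-faithful):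
`HasMaj (ofBlocks (blkBK bI)) (cNormR R₀ H₀ (blkSK (sIK bI)) _ 0) (J†_ν(U)) (cR39 (trBasis N)·e^{δ·rJ}·e^{−δd})`, every `δ ≥ 0` — `B9DivViaGradLettersAtPins.hasMaj_JTcoKH` by name.
[cite: Balaban1985BackgroundPropagators, (3.8) p.392, (3.35) p.396 («U has values in G»), (3.42) p.397, (3.124) p.420; Balaban1984PropagatorsII, (2.51) p.232] -/
theorem hasMaj_JTcoKH_of_mem (x : MemberY d ℓ hd hL b₀ b₁ Mstar) {bI : FBondY x.toKIdx → IBondY x.toKIdx}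
    (hβ1 : ∀ f : FBondY x.toKIdx, (geomT x.D).dist (β x.hN x.D x.hk (bI f)) (blkV1 x.hN x.D f) ≤ 1)
    (B : B9.Backgrounds) (rd : B.Cfg → CfgY (Matrix (Fin N) (Fin N) ℂ) x.toKIdx) {U : B.Cfg}
    (hUG : ∀ μ z, rd U μ z ∈ specialUnitaryUnits (Fin N))
    {δ : ℝ} (hδ : 0 ≤ δ) {R₀ : ℝ} {H₀ : Prop} (hlen : ∀ y : (geo9Y x).Site, 0 ≤ (geo9Y x).len y) (ν : Fin (d + 1)) :
    HasMaj (BlockNorm.ofBlocks (toB6 (geo9Y x) R₀ H₀) (blkBK x.toKIdx bI)) (cNormR R₀ H₀ (blkSK x.toKIdx (sIK x.toKIdx bI)) hlen 0)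
      (JTcoKH x.toKIdx (trBasis N) B rd ν U)
      (fun a a' => cR39 (trBasis N) * Real.exp (δ * rJ d ℓ) * Real.exp (-(δ * (geo9Y x).dist a a'))) := by
  letI : Fintype (geo9K x.toKIdx).Site := (inferInstance : Fintype (geo9Y x).Site)
  exact hasMaj_JTcoKH x.toKIdx (trBasis N) B rd hβ1 (fun μ s => specialUnitaryUnits_le_U1 (hUG μ s)) hδ hlen ν

end Letters

/-! ## §2 The two faces over ANY background carrier `(B, rd)` -/

section Faces

/-- ★★★ **`hdiv.h44Ds` AT THE PINS OVER ANY BACKGROUND CARRIER — `D*_U G₀ ∇*_{U,μ}` OUT OF THE INPUT HÖLDER CLASS `bHK … ε` INTO `𝔠_W⁽⁰⁾`, EVERY MEMBER, EVERY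
`SU(N)`-VALUED `rd U`, EVERY `ε > 0`**: `B9Thm33G0DivRAtPins.h44Ds_pins` with the operator record `𝔬 : Ops (geo9Y x) B …` over an arbitrary carrier `B` read by `rd`,
the regularity premise replaced by `hUG : ∀ μ z, rd U μ z ∈ SU(N)` (all its proof reads), and the pins `hDvs : 𝔬.Dvstar U = DvscoKH … B rd U`,
`hDd : Dd U = fun ν => coordOpK (trBasis N) (fun _ => cdBₗ x.toKIdx (rd U) ν)`; from the rows-19-derived direction members `Thm33G0Dir` (HYPOTHESIS) by
`h44Ds_of_h44m` with `hDs := DvscoKH_eq_sum`, `hJT := hasMaj_JTcoKH_of_mem`, `hdom := bHK_dom`: constant `(d+1)·(cR39 (trBasis N)·e^{δ_J·rJ}·Bi (min ε 1)·c)`, rate `ρ`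
(`0 ≤ ρ ≤ δ₀`, `ρ + σ ≤ δ_J`, `0 ≤ δ_J`).
[cite: Balaban1985BackgroundPropagators, Thm 3.3 (3.44) p.398 + p.398 (remark after (3.47)) + (3.8) p.392 + Thm 3.12 pp.421–423 + (3.35) p.396; Balaban1984PropagatorsII, (2.51)–(2.56) pp.232–233 + Lemma 2.1 (2.61) p.234] -/
theorem h44Ds_of_mem (x : MemberY d ℓ hd hL b₀ b₁ Mstar) [DecidableRel (RelB x.toKIdx)] {bI : FBondY x.toKIdx → IBondY x.toKIdx}
    (hβ1 : ∀ f : FBondY x.toKIdx, (geomT x.D).dist (β x.hN x.D x.hk (bI f)) (blkV1 x.hN x.D f) ≤ 1)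
    (B : B9.Backgrounds) (rd : B.Cfg → CfgY (Matrix (Fin N) (Fin N) ℂ) x.toKIdx)
    {Y Z PX PY : Type} [Fintype Y] [Fintype Z] [Fintype PX] [Fintype PY]
    {𝔬 : Ops (geo9Y x) B (XBK (TrIdx N) x.toKIdx) Y Z (XSK (TrIdx N) x.toKIdx)}
    {𝔭 : HolderProbes (geo9Y x) B (XBK (TrIdx N) x.toKIdx) Y PX PY}
    {Dd Dds : B.Cfg → Fin (d + 1) → Module.End ℝ (XBK (TrIdx N) x.toKIdx → ℝ)}
    {H : Prop} {bHX : ℝ → BlockNorm (toB6 (geo9Y x) 1 H) (XBK (TrIdx N) x.toKIdx → ℝ)} {B₀ : ℝ} {Bh Bi : ℝ → ℝ} {Bi2 : ℝ → ℝ → ℝ}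
    {δ₀ σ c ρ δJ : ℝ} {U : B.Cfg}
    (hUG : ∀ μ z, rd U μ z ∈ specialUnitaryUnits (Fin N))
    (hbHX : bHX = fun ε => letI : Fintype (geo9K x.toKIdx).Site := (inferInstance : Fintype (geo9Y x).Site); bHK x.toKIdx bI ε)
    (hrow : RowSum (toB6 (geo9Y x) 1 H) σ c) (hc : 0 ≤ c) (hBi : ∀ ε, 0 < ε → ε ≤ 1 → 0 ≤ Bi ε)
    (hρ : 0 ≤ ρ) (hρ0 : ρ ≤ δ₀) (hδJ : 0 ≤ δJ) (hρJ : ρ + σ ≤ δJ)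
    (hblk : 𝔬.blk = blkBK x.toKIdx bI) (hblkW : 𝔬.blkW = blkSK x.toKIdx (sIK x.toKIdx bI))
    (hDvs : 𝔬.Dvstar U = DvscoKH x.toKIdx (trBasis N) B rd U)
    (hDd : Dd U = fun ν => coordOpK (trBasis N) (fun _ : Fin (d + 1) => cdBₗ x.toKIdx (rd U) ν))
    (hH0 : Thm33G0Dir 𝔬 𝔭 Dd Dds 1 H bHX B₀ Bh Bi Bi2 δ₀ U)
    (μ : Fin (d + 1)) (ε : ℝ) (hε : 0 < ε) :
    HasMaj (bHX ε) (cNormR 1 H 𝔬.blkW (fun y => (geo9Y_len_pos x y).le) 0) (𝔬.Dvstar U ∘ₗ (𝔬.G0 U ∘ₗ Dds U μ))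
      (fun a b => (Fintype.card (Fin (d + 1)) : ℝ) * (cR39 (trBasis N) * Real.exp (δJ * rJ d ℓ) * Bi (min ε 1) * c) *
        Real.exp (-(ρ * (geo9Y x).dist a b))) := by
  letI : Fintype (geo9K x.toKIdx).Site := (inferInstance : Fintype (geo9Y x).Site)
  subst hbHX
  have hG : GeoOK (geo9Y x) := ⟨geo9Y_dist_triangle x, geo9Y_dist_comm x, geo9K_dist_nonneg x.toKIdx, geo9Y_len_pos x⟩
  have hCJ : 0 ≤ cR39 (trBasis N) * Real.exp (δJ * rJ d ℓ) := mul_nonneg (cR39_nonneg _) (Real.exp_nonneg _)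
  have hDs : 𝔬.Dvstar U = ∑ ν : Fin (d + 1), JTcoKH x.toKIdx (trBasis N) B rd ν U ∘ₗ Dd U ν := by
    rw [hDvs, hDd]
    exact DvscoKH_eq_sum x.toKIdx (trBasis N) B rd U
  have hJT : ∀ ν : Fin (d + 1), HasMaj (BlockNorm.ofBlocks (toB6 (geo9Y x) 1 H) 𝔬.blk) (cNormR 1 H 𝔬.blkW (fun y => (geo9Y_len_pos x y).le) 0)
      (JTcoKH x.toKIdx (trBasis N) B rd ν U)
      (fun a b => cR39 (trBasis N) * Real.exp (δJ * rJ d ℓ) * Real.exp (-(δJ * (geo9Y x).dist a b))) := by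
    intro ν
    rw [hblk, hblkW]
    exact hasMaj_JTcoKH_of_mem x hβ1 B rd hUG hδJ (fun y => (geo9Y_len_pos x y).le) ν
  exact h44Ds_of_h44m hG hrow (fun y => (geo9Y_len_pos x y).le) hBi hCJ hc hρ hρ0 hρJ hH0 hDs hJT (fun ε' hε' => bHK_dom x.toKIdx ε' hε') μ ε hε

/-- ★★★ **THE WHOLE W-c FACE `hLHH` AT THE PINS OVER ANY BACKGROUND CARRIER** — `LettersHHZ 𝔬 𝔭 1 H _ (weightNorm (ofBlocks 𝔬.blkZ) n⁻¹ _) Bq δ₃ U` (the Hölder probe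
`Φ^Y_β ∘ ∇_U ∘ G₀ ∘ Q*` out of the weighted averaging class into `𝔠_P^{(β−1)}`, every `0 ≤ β < 1`) for `𝔬 : Ops (geo9Y x) B …` over an arbitrary carrier `B` read by
`rd`, an `SU(N)`-valued `rd U`, and the pin `hQs : 𝔬.Qstar U = QscoKH … B rd (parBY …) U`: from the rows-19 direction members `hH0 : Thm33G0Dir …` (HYPOTHESIS; field
`h43L β`), the `Q*`-letter `hasMaj_Qstar_of_mem` at rate `δ_Q` and dag-n06-l's `B9Thm313WholeQstarFromG0.pQ_of_h43`, for any `Bq β ≥ Bh β·e^{δ_Q(ℓ+4)}·c` and rates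
`0 ≤ δ₃ ≤ δ₀`, `δ₃ + σ ≤ δ_Q`, `0 ≤ δ_Q` — `B9LettersHHZWholeAtPins.lettersHHZ_pins` re-typed, proof verbatim.
[cite: Balaban1985BackgroundPropagators, (3.126) p.420 + (3.43) p.398 + (3.40) p.397 + (3.153) p.426 + (3.35) p.396 + (3.8) p.392; Balaban1984PropagatorsII, (2.51)–(2.56) pp.232–233 + Lemma 2.1 (2.60)–(2.61) p.234] -/
theorem lettersHHZ_of_mem (x : MemberY d ℓ hd hL b₀ b₁ Mstar) {bI : FBondY x.toKIdx → IBondY x.toKIdx}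
    (hβ1 : ∀ f : FBondY x.toKIdx, (geomT x.D).dist (β x.hN x.D x.hk (bI f)) (blkV1 x.hN x.D f) ≤ 1)
    (B : B9.Backgrounds) (rd : B.Cfg → CfgY (Matrix (Fin N) (Fin N) ℂ) x.toKIdx)
    {Y W PX PY P : Type} [Fintype Y] [Fintype W] [Fintype PX] [Fintype PY]
    {𝔬 : Ops (geo9Y x) B (XBK (TrIdx N) x.toKIdx) Y (XHK (TrIdx N) x.toKIdx) W}
    {𝔭 : HolderProbes (geo9Y x) B (XBK (TrIdx N) x.toKIdx) Y PX PY}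
    {Dd Dds : B.Cfg → P → Module.End ℝ (XBK (TrIdx N) x.toKIdx → ℝ)}
    {H : Prop} {bHX : ℝ → BlockNorm (toB6 (geo9Y x) 1 H) (XBK (TrIdx N) x.toKIdx → ℝ)}
    {B₀ : ℝ} {Bh Bi : ℝ → ℝ} {Bi2 : ℝ → ℝ → ℝ} {δ₀ σ c δ₃ δQ : ℝ} {Bq : ℝ → ℝ} {U : B.Cfg}
    (hUG : ∀ μ z, rd U μ z ∈ specialUnitaryUnits (Fin N))
    (hrow : RowSum (toB6 (geo9Y x) 1 H) σ c) (hc : 0 ≤ c) (hBh : ∀ β, 0 ≤ β → β < 1 → 0 ≤ Bh β)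
    (hδQ : 0 ≤ δQ) (hδ₃ : 0 ≤ δ₃) (hδ₃0 : δ₃ ≤ δ₀) (hδ₃Q : δ₃ + σ ≤ δQ)
    (hBq : ∀ β, 0 ≤ β → β < 1 → Bh β * Real.exp (δQ * ((ℓ : ℝ) + 4)) * c ≤ Bq β)
    (hblk : 𝔬.blk = blkBK x.toKIdx bI) (hblkZ : 𝔬.blkZ = blkHK x.toKIdx)
    (hQs : 𝔬.Qstar U = QscoKH x.toKIdx (trBasis N) B rd (parBY x.toKIdx) U)
    (hH0 : Thm33G0Dir 𝔬 𝔭 Dd Dds 1 H bHX B₀ Bh Bi Bi2 δ₀ U)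
    (hpl : ∀ y : (geo9Y x).Site, 0 ≤ ((((ℓ + 1 : ℕ) : ℝ) ^ (d + 1)) ^ lvl x.hN x.D x.hk y)⁻¹) :
    LettersHHZ 𝔬 𝔭 1 H (fun y => (geo9Y_len_pos x y).le)
      (weightNorm (BlockNorm.ofBlocks (toB6 (geo9Y x) 1 H) 𝔬.blkZ) (fun y => ((((ℓ + 1 : ℕ) : ℝ) ^ (d + 1)) ^ lvl x.hN x.D x.hk y)⁻¹) hpl) Bq δ₃ U := by
  letI : Fintype (geo9K x.toKIdx).Site := (inferInstance : Fintype (geo9Y x).Site)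
  have hG : GeoOK (geo9Y x) := ⟨geo9Y_dist_triangle x, geo9Y_dist_comm x, geo9K_dist_nonneg x.toKIdx, geo9Y_len_pos x⟩
  -- the Q*-letter at rate `δ_Q`, read over the record's block maps `𝔬.blkZ = blkHK`, `𝔬.blk = blkBK bI` and the pinned `𝔬.Qstar U`
  have hqs := hasMaj_Qstar_of_mem (R₀ := (1 : ℝ)) (H₀ := H) x hβ1 B rd hUG hδQ (fun y => (geo9Y_len_pos x y).le) hpl
  rw [← hblkZ, ← hblk, ← hQs] at hqs
  refine ⟨fun β' hβ' hβ'1 => ?_⟩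
  exact pQ_of_h43 hG hrow (hBh β' hβ' hβ'1) (Real.exp_nonneg _) hc hδ₃ hδ₃0 hδ₃Q (hBq β' hβ' hβ'1) (hH0.h43L β' hβ' hβ'1) hqs

end Faces

/-! ## §3 Member forms at node00-def-Y's class-parametric carrier `bg9YR (M_N ℂ) SU(N) R₁ R₂ x` (`c` free, class axiom `MemOfFam SU(N) R₁`) -/

section ClassParametric

/-- ★★ **THE SUP LETTER `Q*(U)` AT THE CLASS-PARAMETRIC CARRIER, EVERY MEMBER, EVERY `U` OF THE CLASS `R₁ x c α₀`** (`R₁` `SU(N)`-valued): `hasMaj_Qstar_of_mem` at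
`B := bg9YR (M_N ℂ) SU(N) R₁ R₂ x`, `rd := fun U => U`, `hUG := mem_of_reg335R hG x hU` — the R-twin of `B9QstarLettersAtPins.hasMaj_Qstar_pins` (its `bg9Y` edition is the
instance `R := regY335 ∕ regY336`, `hG := memOfFam_regY335`).
[cite: Balaban1985BackgroundPropagators, (3.12)–(3.14) p.393, (3.110) p.417, (3.35) p.396, (3.40) p.397, Thm 3.13 p.426; Balaban1984PropagatorsI, (1.18) p.20; Balaban1984PropagatorsII, (2.51) p.232] -/
theorem hasMaj_Qstar_pinsR (x : MemberY d ℓ hd hL b₀ b₁ Mstar) {bI : FBondY x.toKIdx → IBondY x.toKIdx}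
    (hβ1 : ∀ f : FBondY x.toKIdx, (geomT x.D).dist (β x.hN x.D x.hk (bI f)) (blkV1 x.hN x.D f) ≤ 1)
    {R₁ R₂ : RegFamY d ℓ hd hL b₀ b₁ Mstar (Matrix (Fin N) (Fin N) ℂ)} (hG : MemOfFam (specialUnitaryUnits (Fin N)) R₁) {c α₀ : ℝ}
    {U : (bg9YR (Matrix (Fin N) (Fin N) ℂ) (specialUnitaryUnits (Fin N)) R₁ R₂ x).Cfg}
    (hU : (bg9YR (Matrix (Fin N) (Fin N) ℂ) (specialUnitaryUnits (Fin N)) R₁ R₂ x).Reg335 c α₀ U)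
    {δ : ℝ} (hδ : 0 ≤ δ) {R₀ : ℝ} {H₀ : Prop} (hlen : ∀ y : (geo9Y x).Site, 0 ≤ (geo9Y x).len y)
    (hpl : ∀ y : (geo9Y x).Site, 0 ≤ ((((ℓ + 1 : ℕ) : ℝ) ^ (d + 1)) ^ lvl x.hN x.D x.hk y)⁻¹) :
    HasMaj (weightNorm (BlockNorm.ofBlocks (toB6 (geo9Y x) R₀ H₀) (blkHK x.toKIdx))
        (fun y => ((((ℓ + 1 : ℕ) : ℝ) ^ (d + 1)) ^ lvl x.hN x.D x.hk y)⁻¹) hpl)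
      (cNorm R₀ H₀ (blkBK x.toKIdx bI) hlen 0)
      (QscoKH x.toKIdx (trBasis N) (bg9YR (Matrix (Fin N) (Fin N) ℂ) (specialUnitaryUnits (Fin N)) R₁ R₂ x) (fun U => U) (parBY x.toKIdx) U)
      (fun a a' => Real.exp (δ * ((ℓ : ℝ) + 4)) * Real.exp (-(δ * (geo9Y x).dist a a'))) :=
  hasMaj_Qstar_of_mem x hβ1 (bg9YR (Matrix (Fin N) (Fin N) ℂ) (specialUnitaryUnits (Fin N)) R₁ R₂ x) (fun U => U)
    (mem_of_reg335R hG x hU) hδ hlen hpl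

/-- ★★ **THE SUP LETTER `J†_ν(U)` AT THE CLASS-PARAMETRIC CARRIER, EVERY MEMBER, EVERY `U` OF THE CLASS `R₁ x c α₀`**: `hasMaj_JTcoKH_of_mem` at
`B := bg9YR (M_N ℂ) SU(N) R₁ R₂ x`, `rd := fun U => U`, `hUG := mem_of_reg335R hG x hU` — the R-twin of `B9DivViaGradLettersAtPins.hasMaj_JTcoKH_pins`.
[cite: Balaban1985BackgroundPropagators, (3.8) p.392, (3.35) p.396, (3.42) p.397, (3.124) p.420; Balaban1984PropagatorsII, (2.51) p.232] -/
theorem hasMaj_JTcoKH_pinsR (x : MemberY d ℓ hd hL b₀ b₁ Mstar) {bI : FBondY x.toKIdx → IBondY x.toKIdx}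
    (hβ1 : ∀ f : FBondY x.toKIdx, (geomT x.D).dist (β x.hN x.D x.hk (bI f)) (blkV1 x.hN x.D f) ≤ 1)
    {R₁ R₂ : RegFamY d ℓ hd hL b₀ b₁ Mstar (Matrix (Fin N) (Fin N) ℂ)} (hG : MemOfFam (specialUnitaryUnits (Fin N)) R₁) {c α₀ : ℝ}
    {U : (bg9YR (Matrix (Fin N) (Fin N) ℂ) (specialUnitaryUnits (Fin N)) R₁ R₂ x).Cfg}
    (hU : (bg9YR (Matrix (Fin N) (Fin N) ℂ) (specialUnitaryUnits (Fin N)) R₁ R₂ x).Reg335 c α₀ U)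
    {δ : ℝ} (hδ : 0 ≤ δ) {R₀ : ℝ} {H₀ : Prop} (hlen : ∀ y : (geo9Y x).Site, 0 ≤ (geo9Y x).len y) (ν : Fin (d + 1)) :
    HasMaj (BlockNorm.ofBlocks (toB6 (geo9Y x) R₀ H₀) (blkBK x.toKIdx bI)) (cNormR R₀ H₀ (blkSK x.toKIdx (sIK x.toKIdx bI)) hlen 0)
      (JTcoKH x.toKIdx (trBasis N) (bg9YR (Matrix (Fin N) (Fin N) ℂ) (specialUnitaryUnits (Fin N)) R₁ R₂ x) (fun U => U) ν U)
      (fun a a' => cR39 (trBasis N) * Real.exp (δ * rJ d ℓ) * Real.exp (-(δ * (geo9Y x).dist a a'))) :=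
  hasMaj_JTcoKH_of_mem x hβ1 (bg9YR (Matrix (Fin N) (Fin N) ℂ) (specialUnitaryUnits (Fin N)) R₁ R₂ x) (fun U => U)
    (mem_of_reg335R hG x hU) hδ hlen ν

/-- ★★★ **`hdiv.h44Ds` AT THE CLASS-PARAMETRIC CARRIER'S PINS — EVERY MEMBER, EVERY `U` OF THE CLASS `R₁ x c α₀`, EVERY `ε > 0`**: `h44Ds_of_mem` at
`B := bg9YR (M_N ℂ) SU(N) R₁ R₂ x`, `rd := fun U => U`, `hUG := mem_of_reg335R hG x hU` — the R-twin of `B9Thm33G0DivRAtPins.h44Ds_pins` (argument order: the original's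
with `hG` inserted before `hU`); `Thm33G0Dir` (rows 19) stays a HYPOTHESIS.
[cite: Balaban1985BackgroundPropagators, Thm 3.3 (3.44) p.398 + p.398 (remark after (3.47)) + (3.8) p.392 + Thm 3.12 pp.421–423 + (3.35) p.396; Balaban1984PropagatorsII, (2.51)–(2.56) pp.232–233 + Lemma 2.1 (2.61) p.234] -/
theorem h44Ds_pinsR (x : MemberY d ℓ hd hL b₀ b₁ Mstar) [DecidableRel (RelB x.toKIdx)] {bI : FBondY x.toKIdx → IBondY x.toKIdx}
    (hβ1 : ∀ f : FBondY x.toKIdx, (geomT x.D).dist (β x.hN x.D x.hk (bI f)) (blkV1 x.hN x.D f) ≤ 1)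
    {R₁ R₂ : RegFamY d ℓ hd hL b₀ b₁ Mstar (Matrix (Fin N) (Fin N) ℂ)} (hG : MemOfFam (specialUnitaryUnits (Fin N)) R₁)
    {Y Z PX PY : Type} [Fintype Y] [Fintype Z] [Fintype PX] [Fintype PY]
    {𝔬 : Ops (geo9Y x) (bg9YR (Matrix (Fin N) (Fin N) ℂ) (specialUnitaryUnits (Fin N)) R₁ R₂ x) (XBK (TrIdx N) x.toKIdx) Y Z (XSK (TrIdx N) x.toKIdx)}
    {𝔭 : HolderProbes (geo9Y x) (bg9YR (Matrix (Fin N) (Fin N) ℂ) (specialUnitaryUnits (Fin N)) R₁ R₂ x) (XBK (TrIdx N) x.toKIdx) Y PX PY}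
    {Dd Dds : (bg9YR (Matrix (Fin N) (Fin N) ℂ) (specialUnitaryUnits (Fin N)) R₁ R₂ x).Cfg → Fin (d + 1) → Module.End ℝ (XBK (TrIdx N) x.toKIdx → ℝ)}
    {H : Prop} {bHX : ℝ → BlockNorm (toB6 (geo9Y x) 1 H) (XBK (TrIdx N) x.toKIdx → ℝ)} {B₀ : ℝ} {Bh Bi : ℝ → ℝ} {Bi2 : ℝ → ℝ → ℝ}
    {δ₀ σ c ρ δJ c35 α₀ : ℝ} {U : (bg9YR (Matrix (Fin N) (Fin N) ℂ) (specialUnitaryUnits (Fin N)) R₁ R₂ x).Cfg}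
    (hU : (bg9YR (Matrix (Fin N) (Fin N) ℂ) (specialUnitaryUnits (Fin N)) R₁ R₂ x).Reg335 c35 α₀ U)
    (hbHX : bHX = fun ε => letI : Fintype (geo9K x.toKIdx).Site := (inferInstance : Fintype (geo9Y x).Site); bHK x.toKIdx bI ε)
    (hrow : RowSum (toB6 (geo9Y x) 1 H) σ c) (hc : 0 ≤ c) (hBi : ∀ ε, 0 < ε → ε ≤ 1 → 0 ≤ Bi ε)
    (hρ : 0 ≤ ρ) (hρ0 : ρ ≤ δ₀) (hδJ : 0 ≤ δJ) (hρJ : ρ + σ ≤ δJ)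
    (hblk : 𝔬.blk = blkBK x.toKIdx bI) (hblkW : 𝔬.blkW = blkSK x.toKIdx (sIK x.toKIdx bI))
    (hDvs : 𝔬.Dvstar U = DvscoKH x.toKIdx (trBasis N) (bg9YR (Matrix (Fin N) (Fin N) ℂ) (specialUnitaryUnits (Fin N)) R₁ R₂ x) (fun U => U) U)
    (hDd : Dd U = fun ν => coordOpK (trBasis N) (fun _ : Fin (d + 1) => cdBₗ x.toKIdx U ν))
    (hH0 : Thm33G0Dir 𝔬 𝔭 Dd Dds 1 H bHX B₀ Bh Bi Bi2 δ₀ U)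
    (μ : Fin (d + 1)) (ε : ℝ) (hε : 0 < ε) :
    HasMaj (bHX ε) (cNormR 1 H 𝔬.blkW (fun y => (geo9Y_len_pos x y).le) 0) (𝔬.Dvstar U ∘ₗ (𝔬.G0 U ∘ₗ Dds U μ))
      (fun a b => (Fintype.card (Fin (d + 1)) : ℝ) * (cR39 (trBasis N) * Real.exp (δJ * rJ d ℓ) * Bi (min ε 1) * c) *
        Real.exp (-(ρ * (geo9Y x).dist a b))) :=
  h44Ds_of_mem x hβ1 (bg9YR (Matrix (Fin N) (Fin N) ℂ) (specialUnitaryUnits (Fin N)) R₁ R₂ x) (fun U => U) (mem_of_reg335R hG x hU)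
    hbHX hrow hc hBi hρ hρ0 hδJ hρJ hblk hblkW hDvs hDd hH0 μ ε hε

/-- ★★★ **THE WHOLE W-c FACE `hLHH` AT THE CLASS-PARAMETRIC CARRIER'S PINS** — `lettersHHZ_of_mem` at `B := bg9YR (M_N ℂ) SU(N) R₁ R₂ x`, `rd := fun U => U`,
`hUG := mem_of_reg335R hG x hU`: the R-twin of `B9LettersHHZWholeAtPins.lettersHHZ_pins` (argument order: the original's with `hG` inserted before `hU`);
`Thm33G0Dir` (rows 19) stays a HYPOTHESIS.
[cite: Balaban1985BackgroundPropagators, (3.126) p.420 + (3.43) p.398 + (3.40) p.397 + (3.153) p.426 + (3.35) p.396 + (3.8) p.392; Balaban1984PropagatorsII, (2.51)–(2.56) pp.232–233 + Lemma 2.1 (2.60)–(2.61) p.234] -/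
theorem lettersHHZ_pinsR (x : MemberY d ℓ hd hL b₀ b₁ Mstar) {bI : FBondY x.toKIdx → IBondY x.toKIdx}
    (hβ1 : ∀ f : FBondY x.toKIdx, (geomT x.D).dist (β x.hN x.D x.hk (bI f)) (blkV1 x.hN x.D f) ≤ 1)
    {R₁ R₂ : RegFamY d ℓ hd hL b₀ b₁ Mstar (Matrix (Fin N) (Fin N) ℂ)} (hG : MemOfFam (specialUnitaryUnits (Fin N)) R₁)
    {Y W PX PY P : Type} [Fintype Y] [Fintype W] [Fintype PX] [Fintype PY]
    {𝔬 : Ops (geo9Y x) (bg9YR (Matrix (Fin N) (Fin N) ℂ) (specialUnitaryUnits (Fin N)) R₁ R₂ x) (XBK (TrIdx N) x.toKIdx) Y (XHK (TrIdx N) x.toKIdx) W}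
    {𝔭 : HolderProbes (geo9Y x) (bg9YR (Matrix (Fin N) (Fin N) ℂ) (specialUnitaryUnits (Fin N)) R₁ R₂ x) (XBK (TrIdx N) x.toKIdx) Y PX PY}
    {Dd Dds : (bg9YR (Matrix (Fin N) (Fin N) ℂ) (specialUnitaryUnits (Fin N)) R₁ R₂ x).Cfg → P → Module.End ℝ (XBK (TrIdx N) x.toKIdx → ℝ)}
    {H : Prop} {bHX : ℝ → BlockNorm (toB6 (geo9Y x) 1 H) (XBK (TrIdx N) x.toKIdx → ℝ)}
    {B₀ : ℝ} {Bh Bi : ℝ → ℝ} {Bi2 : ℝ → ℝ → ℝ} {δ₀ σ c δ₃ δQ c35 α₀ : ℝ} {Bq : ℝ → ℝ}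
    {U : (bg9YR (Matrix (Fin N) (Fin N) ℂ) (specialUnitaryUnits (Fin N)) R₁ R₂ x).Cfg}
    (hU : (bg9YR (Matrix (Fin N) (Fin N) ℂ) (specialUnitaryUnits (Fin N)) R₁ R₂ x).Reg335 c35 α₀ U)
    (hrow : RowSum (toB6 (geo9Y x) 1 H) σ c) (hc : 0 ≤ c) (hBh : ∀ β, 0 ≤ β → β < 1 → 0 ≤ Bh β)
    (hδQ : 0 ≤ δQ) (hδ₃ : 0 ≤ δ₃) (hδ₃0 : δ₃ ≤ δ₀) (hδ₃Q : δ₃ + σ ≤ δQ)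
    (hBq : ∀ β, 0 ≤ β → β < 1 → Bh β * Real.exp (δQ * ((ℓ : ℝ) + 4)) * c ≤ Bq β)
    (hblk : 𝔬.blk = blkBK x.toKIdx bI) (hblkZ : 𝔬.blkZ = blkHK x.toKIdx)
    (hQs : 𝔬.Qstar U = QscoKH x.toKIdx (trBasis N) (bg9YR (Matrix (Fin N) (Fin N) ℂ) (specialUnitaryUnits (Fin N)) R₁ R₂ x) (fun U => U) (parBY x.toKIdx) U)
    (hH0 : Thm33G0Dir 𝔬 𝔭 Dd Dds 1 H bHX B₀ Bh Bi Bi2 δ₀ U)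
    (hpl : ∀ y : (geo9Y x).Site, 0 ≤ ((((ℓ + 1 : ℕ) : ℝ) ^ (d + 1)) ^ lvl x.hN x.D x.hk y)⁻¹) :
    LettersHHZ 𝔬 𝔭 1 H (fun y => (geo9Y_len_pos x y).le)
      (weightNorm (BlockNorm.ofBlocks (toB6 (geo9Y x) 1 H) 𝔬.blkZ) (fun y => ((((ℓ + 1 : ℕ) : ℝ) ^ (d + 1)) ^ lvl x.hN x.D x.hk y)⁻¹) hpl) Bq δ₃ U :=
  lettersHHZ_of_mem x hβ1 (bg9YR (Matrix (Fin N) (Fin N) ℂ) (specialUnitaryUnits (Fin N)) R₁ R₂ x) (fun U => U) (mem_of_reg335R hG x hU)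
    hrow hc hBh hδQ hδ₃ hδ₃0 hδ₃Q hBq hblk hblkZ hQs hH0 hpl

/-- ★★ **THE WHOLE FACE AT THE CLOSED LETTER, CLASS-PARAMETRIC CARRIER** — `lettersHHZ_pinsR` with `Bq β := Bh β·e^{δ_Q(ℓ+4)}·c` (nothing to choose); the R-twin of
`B9LettersHHZWholeAtPins.lettersHHZ_pins_closed`.
[cite: Balaban1985BackgroundPropagators, (3.126) p.420 + (3.43) p.398 + (3.153) p.426 + (3.35) p.396; Balaban1984PropagatorsII, (2.52)–(2.56) pp.232–233 + Lemma 2.1 (2.61) p.234] -/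
theorem lettersHHZ_pinsR_closed (x : MemberY d ℓ hd hL b₀ b₁ Mstar) {bI : FBondY x.toKIdx → IBondY x.toKIdx}
    (hβ1 : ∀ f : FBondY x.toKIdx, (geomT x.D).dist (β x.hN x.D x.hk (bI f)) (blkV1 x.hN x.D f) ≤ 1)
    {R₁ R₂ : RegFamY d ℓ hd hL b₀ b₁ Mstar (Matrix (Fin N) (Fin N) ℂ)} (hG : MemOfFam (specialUnitaryUnits (Fin N)) R₁)
    {Y W PX PY P : Type} [Fintype Y] [Fintype W] [Fintype PX] [Fintype PY]
    {𝔬 : Ops (geo9Y x) (bg9YR (Matrix (Fin N) (Fin N) ℂ) (specialUnitaryUnits (Fin N)) R₁ R₂ x) (XBK (TrIdx N) x.toKIdx) Y (XHK (TrIdx N) x.toKIdx) W}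
    {𝔭 : HolderProbes (geo9Y x) (bg9YR (Matrix (Fin N) (Fin N) ℂ) (specialUnitaryUnits (Fin N)) R₁ R₂ x) (XBK (TrIdx N) x.toKIdx) Y PX PY}
    {Dd Dds : (bg9YR (Matrix (Fin N) (Fin N) ℂ) (specialUnitaryUnits (Fin N)) R₁ R₂ x).Cfg → P → Module.End ℝ (XBK (TrIdx N) x.toKIdx → ℝ)}
    {H : Prop} {bHX : ℝ → BlockNorm (toB6 (geo9Y x) 1 H) (XBK (TrIdx N) x.toKIdx → ℝ)}
    {B₀ : ℝ} {Bh Bi : ℝ → ℝ} {Bi2 : ℝ → ℝ → ℝ} {δ₀ σ c δ₃ δQ c35 α₀ : ℝ}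
    {U : (bg9YR (Matrix (Fin N) (Fin N) ℂ) (specialUnitaryUnits (Fin N)) R₁ R₂ x).Cfg}
    (hU : (bg9YR (Matrix (Fin N) (Fin N) ℂ) (specialUnitaryUnits (Fin N)) R₁ R₂ x).Reg335 c35 α₀ U)
    (hrow : RowSum (toB6 (geo9Y x) 1 H) σ c) (hc : 0 ≤ c) (hBh : ∀ β, 0 ≤ β → β < 1 → 0 ≤ Bh β)
    (hδQ : 0 ≤ δQ) (hδ₃ : 0 ≤ δ₃) (hδ₃0 : δ₃ ≤ δ₀) (hδ₃Q : δ₃ + σ ≤ δQ)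
    (hblk : 𝔬.blk = blkBK x.toKIdx bI) (hblkZ : 𝔬.blkZ = blkHK x.toKIdx)
    (hQs : 𝔬.Qstar U = QscoKH x.toKIdx (trBasis N) (bg9YR (Matrix (Fin N) (Fin N) ℂ) (specialUnitaryUnits (Fin N)) R₁ R₂ x) (fun U => U) (parBY x.toKIdx) U)
    (hH0 : Thm33G0Dir 𝔬 𝔭 Dd Dds 1 H bHX B₀ Bh Bi Bi2 δ₀ U)
    (hpl : ∀ y : (geo9Y x).Site, 0 ≤ ((((ℓ + 1 : ℕ) : ℝ) ^ (d + 1)) ^ lvl x.hN x.D x.hk y)⁻¹) :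
    LettersHHZ 𝔬 𝔭 1 H (fun y => (geo9Y_len_pos x y).le)
      (weightNorm (BlockNorm.ofBlocks (toB6 (geo9Y x) 1 H) 𝔬.blkZ) (fun y => ((((ℓ + 1 : ℕ) : ℝ) ^ (d + 1)) ^ lvl x.hN x.D x.hk y)⁻¹) hpl)
      (fun β => Bh β * Real.exp (δQ * ((ℓ : ℝ) + 4)) * c) δ₃ U :=
  lettersHHZ_pinsR x hβ1 hG hU hrow hc hBh hδQ hδ₃ hδ₃0 hδ₃Q (fun _ _ _ => le_rfl) hblk hblkZ hQs hH0 hpl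

end ClassParametric

end Literature.MathematicalPhysics.QuantumFieldTheory.Balaban1983to89.B9Thm33G0DivRLettersHHZAtPinsR

end
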